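import Mathlib
import HarnessLib
import Summits.NavierStokesRegularity.NavierStokesRegularity.Theorems.UnthreadedDoorNetFluxGrowthCap
import Summits.NavierStokesRegularity.NavierStokesRegularity.Theorems.UnthreadedDoorNetFluxEnvelopeOneSided

/-!
# Route `UnthreadedDoor`, crux `PoloidalLiouville` (stmt-NavierStokesRegularity-1222), WALL W1 `stub_scalarLiouville` —
# crux idea «netflux-typei-gap» (ns-idea-14, LINE v5): stub NF-6 `NearCentreFlux`, part 1 — OSCILLATION COMPARISON LEMMAS

KEY-NS #156/#157 (director-ns g16; author ns-idea-14, «NETFLUX LINE v5» bcd4955f0879).  `NetFlux.NearCentreFlux` (Lines file §0,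
(NC)) asks for the near-centre kinematics of the net flux density `w(t,a) = a · osc_{S_a(x₀)} T(t)` of a toroidal representation
`curl v = ∇T × (x − x₀)`: (a) `w ≤ κ a²`, (b) `w(t,·)` is `κ a₀`-Lipschitz on `]0,a₀[`, (c) `|w(t,a) − w(t',a)| ≤ κ a² |t − t'|`.
This file proves the two COMPARISON LEMMAS behind (b) and (c), both by the great-circle bound of NF-0
(`sub_le_pi_mul_of_norm_cross_gradient_le`, p660776) applied to a DIFFERENCE of two functions:

* two radii, one time (→ (b)): `osc_{S_ρ} T − osc_{S_ρ'} T ≤ Ψ(ξ) − Ψ(η)` with `Ψ(ζ) = T(x₀ + ρζ) − T(x₀ + ρ'ζ)` on the UNIT sphere and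
  `∇Ψ(ζ) × ζ = ω(x₀ + ρζ) − ω(x₀ + ρ'ζ)`, of norm `≤ L |ρ − ρ'|` when `‖Dω‖ ≤ L` on `B̄(x₀,1)`: so `osc` is `πL`-Lipschitz in the
  radius on `]0,1]` (`abs_sphOsc_sub_sphOsc_le_radius`);
* one radius, two fields (→ (c)): `osc_{S_a} T − osc_{S_a} T' ≤ π K` when `‖ω − ω'‖ ≤ K` on `S_a(x₀)` for two representations
  `curl v = ∇T × (x − x₀)`, `curl v' = ∇T' × (x − x₀)` (`abs_sphOsc_sub_sphOsc_le_of_norm_curl_sub_le`),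
plus `sphInf_le`, `exists_eq_sphInf`, `sphOsc_nonneg_of_continuousOn`, `sphOsc_le_of_fderiv_curl_le` (`osc ≤ π L a`).  No derivative of the
representation and no symmetry of second derivatives is used.

WHAT THIS IS NOT: no NS-regularity statement is touched; pure kinematics of one crux idea; `NearCentreFlux` itself is assembled in
the sequel file; `PoloidalLiouville` (1222), W1, the line's rung target and the summit stay OPEN.
`--supports stmt-NavierStokesRegularity-1222 --as helper`.  [folklore]
-/

noncomputable section

-- the summit and its single sub-problem share the name (CONVENTIONS §1)
set_option linter.dupNamespace false

open Set Function Filter Topology InnerProductSpace MeasureTheory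
open scoped RealInnerProductSpace ContDiff

namespace Summit.NavierStokesRegularity.NavierStokesRegularity.Theorems.PoloidalLiouville.NetFlux

open Literature.Analysis Literature.Analysis.FluidPDE

variable {f : E3 → ℝ} {x₀ : E3} {r : ℝ}

/-! ### The spherical infimum and the oscillation -/

/-- `min_{S_r(x₀)} f ≤ f y` for `y ∈ S_r(x₀)`. [folklore] -/
theorem sphInf_le (hf : ContinuousOn f (Metric.sphere x₀ r)) {y : E3} (hy : y ∈ Metric.sphere x₀ r) :
    sphInf f x₀ r ≤ f y := by
  rw [sphInf_eq_neg_sphSup_neg, neg_le]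
  exact le_sphSup (f := fun x => -f x) hf.neg hy

/-- **Attainment of `sphInf`**: `∃ x ∈ S_r(x₀)`, `f x = min_{S_r(x₀)} f`. [folklore] -/
theorem exists_eq_sphInf (hf : ContinuousOn f (Metric.sphere x₀ r)) (hr : 0 ≤ r) :
    ∃ x ∈ Metric.sphere x₀ r, f x = sphInf f x₀ r := by
  obtain ⟨x, hx, h⟩ := exists_eq_sphSup (f := fun x => -f x) hf.neg hr
  exact ⟨x, hx, by rw [sphInf_eq_neg_sphSup_neg, ← h, neg_neg]⟩

/-- `osc_{S_r(x₀)} f ≥ 0` (for `f` continuous on the sphere, `r ≥ 0`). [folklore] -/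
theorem sphOsc_nonneg_of_continuousOn (hf : ContinuousOn f (Metric.sphere x₀ r)) (hr : 0 ≤ r) : 0 ≤ sphOsc f x₀ r := by
  obtain ⟨x, hx, h⟩ := exists_eq_sphSup hf hr
  have h2 := sphInf_le hf hx
  unfold sphOsc
  linarith

/-- **`osc_{S_a(x₀)} T ≤ π L a`** for a toroidal representation with `‖D(curl v)‖ ≤ L` on `closedBall x₀ a` (NF-0 with `K = L a`).
[folklore] -/
theorem sphOsc_le_of_fderiv_curl_le (v : E3 → E3) (x₀ : E3) (T : E3 → ℝ) {a L : ℝ} (ha : 0 < a) (hv : ContDiff ℝ 2 v)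
    (hT : ContDiffOn ℝ 1 T ({x₀}ᶜ)) (hrep : ∀ x, curl v x = cross (gradient T x) (x - x₀))
    (hL : ∀ x ∈ Metric.closedBall x₀ a, ‖fderiv ℝ (curl v) x‖ ≤ L) :
    sphOsc T x₀ a ≤ Real.pi * L * a := by
  have h := netFlux_le_sq v x₀ T ha hv hT hrep hL
  unfold netFlux at h
  have e : Real.pi * L * a ^ 2 = a * (Real.pi * L * a) := by ring
  have h2 : a * sphOsc T x₀ a ≤ a * (Real.pi * L * a) := by rw [← e]; exact h
  exact le_of_mul_le_mul_left h2 ha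

/-! ### Algebra of the cross product in the first argument -/

/-- `(ρ g − ρ' g') × ζ = g × (ρ ζ) − g' × (ρ' ζ)`. [folklore] -/
theorem cross_smul_sub_smul_left (g g' ζ : E3) (ρ ρ' : ℝ) :
    cross (ρ • g - ρ' • g') ζ = cross g (ρ • ζ) - cross g' (ρ' • ζ) := by
  simp only [← crossCLM_apply, map_sub, map_smul, _root_.sub_apply, _root_.smul_apply]

/-- `(g − g') × z = g × z − g' × z`. [folklore] -/
theorem cross_sub_left' (g g' z : E3) : cross (g - g') z = cross g z - cross g' z := by
  simp only [← crossCLM_apply, map_sub, _root_.sub_apply]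

/-! ### Two radii, one time: `osc` is `πL`-Lipschitz in the radius on `]0,1]` -/

/-- **Two-radius comparison**: for `v ∈ C²` with `curl v = ∇T × (x − x₀)`, `T ∈ C¹` off `x₀`, `‖D(curl v)‖ ≤ L` on `B̄(x₀,1)` and
`ρ, ρ' ∈ ]0,1]`: `osc_{S_ρ} T − osc_{S_ρ'} T ≤ π L |ρ − ρ'|` (great circle on the unit sphere for `Ψ(ζ) = T(x₀+ρζ) − T(x₀+ρ'ζ)`,
`∇Ψ(ζ) × ζ = ω(x₀+ρζ) − ω(x₀+ρ'ζ)`). [folklore] -/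
theorem sphOsc_sub_sphOsc_le_radius {v : E3 → E3} {T : E3 → ℝ} {L ρ ρ' : ℝ} (hv : ContDiff ℝ 2 v)
    (hT : ContDiffOn ℝ 1 T ({x₀}ᶜ)) (hrep : ∀ x, curl v x = cross (gradient T x) (x - x₀))
    (hL : ∀ x ∈ Metric.closedBall x₀ 1, ‖fderiv ℝ (curl v) x‖ ≤ L)
    (hρ : 0 < ρ) (hρ1 : ρ ≤ 1) (hρ' : 0 < ρ') (hρ'1 : ρ' ≤ 1) :
    sphOsc T x₀ ρ - sphOsc T x₀ ρ' ≤ Real.pi * (L * |ρ - ρ'|) := by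
  have hTc : ContinuousOn T ({x₀}ᶜ) := hT.continuousOn
  have hcρ := continuousOn_sphere_of_continuousOn_compl hTc hρ
  have hcρ' := continuousOn_sphere_of_continuousOn_compl hTc hρ'
  have hω : ContDiff ℝ 1 (curl v) := contDiff_curl (n := 1) (by exact_mod_cast hv)
  -- extremal points at radius `ρ`, as directions on the unit sphere
  obtain ⟨p, hp, hsup⟩ := exists_eq_sphSup hcρ hρ.le
  obtain ⟨q, hq, hinf⟩ := exists_eq_sphInf hcρ hρ.le
  rw [sphere_eq_image_unitSphere x₀ hρ] at hp hq
  obtain ⟨ξ, hξ, rfl⟩ := hp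
  obtain ⟨η, hη, rfl⟩ := hq
  -- the comparison function on the unit sphere
  have hm : ∀ {σ : ℝ}, 0 < σ → MapsTo (fun ζ : E3 => x₀ + σ • ζ) ({0}ᶜ) ({x₀}ᶜ) := by
    intro σ hσ ζ hζ h0
    simp only [mem_singleton_iff, add_eq_left, smul_eq_zero] at h0
    exact h0.elim (fun h => hσ.ne' h) (fun h => hζ h)
  have hdil : ∀ {σ : ℝ}, 0 < σ → ContDiffOn ℝ 1 (fun ζ : E3 => T (x₀ + σ • ζ)) ({0}ᶜ) := fun {σ} hσ =>
    hT.comp (contDiffOn_const.add (contDiffOn_id.const_smul σ)) (hm hσ)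
  set Ψ : E3 → ℝ := fun ζ => T (x₀ + ρ • ζ) - T (x₀ + ρ' • ζ) with hΨ
  have hΨd : ContDiffOn ℝ 1 Ψ ({0}ᶜ) := (hdil hρ).sub (hdil hρ')
  -- `∇Ψ(ζ) × ζ = ω(x₀ + ρζ) − ω(x₀ + ρ'ζ)`, of norm `≤ L |ρ − ρ'|`
  have hK : ∀ ζ ∈ Metric.sphere (0 : E3) 1, ‖cross (gradient Ψ ζ) (ζ - 0)‖ ≤ L * |ρ - ρ'| := by
    intro ζ hζ
    have hζ1 : ‖ζ‖ = 1 := by simpa using hζ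
    have hne : ∀ {σ : ℝ}, 0 < σ → x₀ + σ • ζ ≠ x₀ := fun hσ => center_add_smul_ne hσ hζ
    have hTd : ∀ {σ : ℝ}, 0 < σ → DifferentiableAt ℝ T (x₀ + σ • ζ) := fun hσ =>
      (hT.differentiableOn one_ne_zero _ (hne hσ)).differentiableAt (isOpen_compl_singleton.mem_nhds (hne hσ))
    have hF : ∀ {σ : ℝ}, 0 < σ →
        HasFDerivAt (fun y : E3 => T (x₀ + σ • y)) (σ • fderiv ℝ T (x₀ + σ • ζ)) ζ := by
      intro σ hσ
      have h1 : HasFDerivAt (fun y : E3 => x₀ + σ • y) (σ • ContinuousLinearMap.id ℝ E3) ζ :=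
        ((hasFDerivAt_id ζ).const_smul σ).const_add x₀
      have h2 := (hTd hσ).hasFDerivAt.comp ζ h1
      rw [ContinuousLinearMap.comp_smul, ContinuousLinearMap.comp_id] at h2
      exact h2
    have hΨg : gradient Ψ ζ = ρ • gradient T (x₀ + ρ • ζ) - ρ' • gradient T (x₀ + ρ' • ζ) := by
      have hΨ' : HasFDerivAt Ψ (ρ • fderiv ℝ T (x₀ + ρ • ζ) - ρ' • fderiv ℝ T (x₀ + ρ' • ζ)) ζ := (hF hρ).sub (hF hρ')
      unfold gradient
      rw [hΨ'.fderiv, map_sub, map_smul, map_smul]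
    have hc : cross (gradient Ψ ζ) ζ = curl v (x₀ + ρ • ζ) - curl v (x₀ + ρ' • ζ) := by
      rw [hΨg, cross_smul_sub_smul_left, hrep, hrep, add_sub_cancel_left, add_sub_cancel_left]
    have hmem : ∀ {σ : ℝ}, 0 < σ → σ ≤ 1 → x₀ + σ • ζ ∈ Metric.closedBall x₀ 1 := by
      intro σ hσ hσ1
      rw [Metric.mem_closedBall, dist_eq_norm, add_sub_cancel_left, norm_smul, Real.norm_of_nonneg hσ.le, hζ1, mul_one]
      exact hσ1
    have hmvt := (convex_closedBall x₀ 1).norm_image_sub_le_of_norm_fderiv_le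
      (fun y _ => (hω.differentiable one_ne_zero) y) hL (hmem hρ' hρ'1) (hmem hρ hρ1)
    rw [add_sub_add_left_eq_sub, ← sub_smul, norm_smul, hζ1, mul_one, Real.norm_eq_abs] at hmvt
    rw [sub_zero, hc]
    exact hmvt
  -- great circle on the unit sphere
  have hgc := sub_le_pi_mul_of_norm_cross_gradient_le (x₀ := (0 : E3)) (r := 1) one_pos hΨd hK hη hξ
  -- comparison with the extremal values at radius `ρ'`
  have hmemS : ∀ {ζ : E3}, ζ ∈ Metric.sphere (0 : E3) 1 → x₀ + ρ' • ζ ∈ Metric.sphere x₀ ρ' := by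
    intro ζ hζ
    rw [sphere_eq_image_unitSphere x₀ hρ']
    exact ⟨ζ, hζ, rfl⟩
  have h1 : T (x₀ + ρ' • ξ) ≤ sphSup T x₀ ρ' := le_sphSup hcρ' (hmemS hξ)
  have h2 : sphInf T x₀ ρ' ≤ T (x₀ + ρ' • η) := sphInf_le hcρ' (hmemS hη)
  unfold sphOsc
  rw [← hsup, ← hinf]
  simp only [hΨ] at hgc
  linarith

/-- **`osc_{S_ρ(x₀)} T` is `πL`-Lipschitz in `ρ ∈ ]0,1]`** (symmetrised two-radius comparison). [folklore] -/
theorem abs_sphOsc_sub_sphOsc_le_radius {v : E3 → E3} {T : E3 → ℝ} {L ρ ρ' : ℝ} (hv : ContDiff ℝ 2 v)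
    (hT : ContDiffOn ℝ 1 T ({x₀}ᶜ)) (hrep : ∀ x, curl v x = cross (gradient T x) (x - x₀))
    (hL : ∀ x ∈ Metric.closedBall x₀ 1, ‖fderiv ℝ (curl v) x‖ ≤ L)
    (hρ : 0 < ρ) (hρ1 : ρ ≤ 1) (hρ' : 0 < ρ') (hρ'1 : ρ' ≤ 1) :
    |sphOsc T x₀ ρ - sphOsc T x₀ ρ'| ≤ Real.pi * L * |ρ - ρ'| := by
  have h₁ := sphOsc_sub_sphOsc_le_radius hv hT hrep hL hρ hρ1 hρ' hρ'1
  have h₂ := sphOsc_sub_sphOsc_le_radius hv hT hrep hL hρ' hρ'1 hρ hρ1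
  rw [abs_sub_comm ρ' ρ] at h₂
  rw [abs_le]
  constructor <;> nlinarith [h₁, h₂]

/-! ### One radius, two fields: `osc` moves by at most `π · sup_{S_a} ‖ω − ω'‖` -/

/-- **Two-field comparison on one sphere**: for two toroidal representations `curl v = ∇T × (x − x₀)`, `curl v' = ∇T' × (x − x₀)`
(`T, T' ∈ C¹` off `x₀`) with `‖curl v − curl v'‖ ≤ K` on `S_a(x₀)`, `a > 0`: `osc_{S_a} T − osc_{S_a} T' ≤ π K` (great circle for
`Φ = T − T'`, `∇Φ × (x − x₀) = ω − ω'`). [folklore] -/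
theorem sphOsc_sub_sphOsc_le_of_norm_curl_sub_le {v v' : E3 → E3} {T T' : E3 → ℝ} {a K : ℝ} (ha : 0 < a)
    (hT : ContDiffOn ℝ 1 T ({x₀}ᶜ)) (hT' : ContDiffOn ℝ 1 T' ({x₀}ᶜ))
    (hrep : ∀ x, curl v x = cross (gradient T x) (x - x₀)) (hrep' : ∀ x, curl v' x = cross (gradient T' x) (x - x₀))
    (hK : ∀ x ∈ Metric.sphere x₀ a, ‖curl v x - curl v' x‖ ≤ K) :
    sphOsc T x₀ a - sphOsc T' x₀ a ≤ Real.pi * K := by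
  have hc := continuousOn_sphere_of_continuousOn_compl hT.continuousOn ha
  have hc' := continuousOn_sphere_of_continuousOn_compl hT'.continuousOn ha
  obtain ⟨p, hp, hsup⟩ := exists_eq_sphSup hc ha.le
  obtain ⟨q, hq, hinf⟩ := exists_eq_sphInf hc ha.le
  set Φ : E3 → ℝ := fun y => T y - T' y with hΦ
  have hΦd : ContDiffOn ℝ 1 Φ ({x₀}ᶜ) := hT.sub hT'
  have hKΦ : ∀ x ∈ Metric.sphere x₀ a, ‖cross (gradient Φ x) (x - x₀)‖ ≤ K := by
    intro x hx
    have hxne : x ≠ x₀ := ne_center_of_mem_sphere ha hx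
    have hd : ∀ {g : E3 → ℝ}, ContDiffOn ℝ 1 g ({x₀}ᶜ) → DifferentiableAt ℝ g x := fun hg =>
      (hg.differentiableOn one_ne_zero _ hxne).differentiableAt (isOpen_compl_singleton.mem_nhds hxne)
    have hg : gradient Φ x = gradient T x - gradient T' x := by
      have hΦ' : HasFDerivAt Φ (fderiv ℝ T x - fderiv ℝ T' x) x := (hd hT).hasFDerivAt.sub (hd hT').hasFDerivAt
      unfold gradient
      rw [hΦ'.fderiv, map_sub]
    rw [hg, cross_sub_left', ← hrep, ← hrep']
    exact hK x hx
  have hgc := sub_le_pi_mul_of_norm_cross_gradient_le ha hΦd hKΦ hq hp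
  have h1 : T' p ≤ sphSup T' x₀ a := le_sphSup hc' hp
  have h2 : sphInf T' x₀ a ≤ T' q := sphInf_le hc' hq
  unfold sphOsc
  rw [← hsup, ← hinf]
  simp only [hΦ] at hgc
  linarith

/-- **Symmetrised two-field comparison**: `|osc_{S_a} T − osc_{S_a} T'| ≤ π K`. [folklore] -/
theorem abs_sphOsc_sub_sphOsc_le_of_norm_curl_sub_le {v v' : E3 → E3} {T T' : E3 → ℝ} {a K : ℝ} (ha : 0 < a)
    (hT : ContDiffOn ℝ 1 T ({x₀}ᶜ)) (hT' : ContDiffOn ℝ 1 T' ({x₀}ᶜ))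
    (hrep : ∀ x, curl v x = cross (gradient T x) (x - x₀)) (hrep' : ∀ x, curl v' x = cross (gradient T' x) (x - x₀))
    (hK : ∀ x ∈ Metric.sphere x₀ a, ‖curl v x - curl v' x‖ ≤ K) :
    |sphOsc T x₀ a - sphOsc T' x₀ a| ≤ Real.pi * K := by
  have h₁ := sphOsc_sub_sphOsc_le_of_norm_curl_sub_le ha hT hT' hrep hrep' hK
  have hK' : ∀ x ∈ Metric.sphere x₀ a, ‖curl v' x - curl v x‖ ≤ K := fun x hx => by
    rw [norm_sub_rev]; exact hK x hx
  have h₂ := sphOsc_sub_sphOsc_le_of_norm_curl_sub_le ha hT' hT hrep' hrep hK'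
  rw [abs_le]
  constructor <;> linarith

end Summit.NavierStokesRegularity.NavierStokesRegularity.Theorems.PoloidalLiouville.NetFlux

end
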